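import Summits.NavierStokesRegularity.NavierStokesRegularity.Theorems.TypeIliouvilleNoTypeII.Negative.NSISuperCascadeNotTypeI
import Literature.Barriers.NavierStokesRegularity.SchefferSwitchedSingular
import HarnessLib

/-!
# The super-similar NSI cascade: first-blow-up bound, singular point and the super-`1/2` rate (brick B2, off-spine clauses)

Negative-lane support file for `stmt-NavierStokesRegularity-0056`; the OFF-SPINE clauses of the
barrier fact `Literature.Barriers.NavierStokesRegularity.NSITypeIIBlowup` for the generalised glued
field `𝔲 = glueG T σ τ a z u` of `NSISuperCascadeNotTypeI.lean` (clock `σ`, contraction `τ`,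
amplitude `a`; `T₀ = blowupTime T σ`, `x₀ = blowupPoint τ z`), twins of the tree's
`SchefferSwitchedSingular.lean` / `…Integrability.lean` (`exists_bound_norm`) with `τ⁻¹ ↦ a`:

* `exists_bound_glueG` — **`T₀` is the FIRST blow-up time**: `𝔲` is bounded on `[0,T'] × ℝ³` for
  every `T' < T₀` (finitely many pieces below `T'`; `a ≥ 1`);
* `not_isRegularPoint_glueG` — **`(T₀, x₀)` is a singular point** (`a > 1`): the `j`-th piece
  equals `aʲu(0,x*)` at `(t_j, Γʲx*) → (T₀, x₀)`; continuity on the closed strip;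
* `exists_rate_glueG` — **the super-`1/2` rate** (`aσ > 1`): with `β = log_{σ⁻²} a > 1/2` and some
  `c > 0`, at every `t ∈ [0, T₀)` some point has `‖𝔲(t,x)‖ ≥ c (T₀ - t)^{-β}`; the uniform
  nontriviality `inf_{s ∈ [0,T]} max_y ‖u(s,y)‖ > 0` of the block (`exists_pos_forall_exists_le_norm`)
  comes from compactness of `[0,T]`, joint continuity and `tsupport u(s) = G ≠ ∅`.

No new definitions; structure-free hypotheses `(h : IsNSIBlock T ν₀ τ z G u) (hσ₀ : 0 < σ) …`;
independent of the spine files (pieces / strips / weak NSI solution, with the slice clause: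
ns-typeII-critic-1, `NSISuperCascadePieces/Strips/Weak.lean`) and consumed by name in the assembly
`NSITypeIIBlowupHolds.lean`.

## References

* W. S. Ożański, arXiv:1709.00602 (2017), §2 pp. 6–7, §2.1. [`Ozanski2017NSISingular`]
* V. Scheffer, Comm. Math. Phys. 101 (1985), Lemma 2.3 (2.30). [`Scheffer1985`]
-/

noncomputable section

set_option linter.dupNamespace false

open Set Function Filter Topology TopologicalSpace Metric MeasureTheory Module
open scoped ENNReal InnerProductSpace RealInnerProductSpace ContDiff Laplacian

namespace Summit.NavierStokesRegularity.NavierStokesRegularity.Theorems.TypeIliouvilleNoTypeIINegative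

open Literature.Analysis.FluidPDE Literature.Barriers.NavierStokesRegularity
open Literature.Barriers.NavierStokesRegularity.Scheffer
open Literature.Barriers.NavierStokesRegularity.IsNSIBlock

variable {T ν₀ τ σ a : ℝ} {z : EuclideanSpace ℝ (Fin 3)} {G : Set (EuclideanSpace ℝ (Fin 3))}
  {u : ℝ → EuclideanSpace ℝ (Fin 3) → EuclideanSpace ℝ (Fin 3)}

/-! ### Auxiliary facts (private; the public twins live in the spine files) -/

/-- Outside `[0, T₀)` the generalised glued field vanishes (`0 < σ < 1`). [folklore] -/
private theorem glueG_eq_zero_of_notMem_aux (hT : 0 < T) (hσ₀ : 0 < σ) (hσ₁ : σ < 1) (τ a : ℝ)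
    (z : EuclideanSpace ℝ (Fin 3)) (u : ℝ → EuclideanSpace ℝ (Fin 3) → EuclideanSpace ℝ (Fin 3))
    {t : ℝ} (ht : t ∉ Ico 0 (blowupTime T σ)) : glueG T σ τ a z u t = 0 := by
  rcases lt_or_ge t 0 with h0 | h0
  · exact glueG_eq_zero_of_neg hT hσ₀ τ a z u h0
  · exact glueG_eq_zero_of_le hT hσ₀ hσ₁ τ a z u (not_lt.1 fun h1 => ht ⟨h0, h1⟩)

/-- The `j`-th generalised piece is jointly smooth on an open slab around `[t_j, t_{j+1}]`.
[cite: Ozanski2017NSISingular, §2 (2.4)] -/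
private theorem isSmoothSpaceTimeOn_pieceG_aux (h : IsNSIBlock T ν₀ τ z G u) (σ a : ℝ) (j : ℕ) :
    ∃ η : ℝ, 0 < η ∧ IsSmoothSpaceTimeOn
      ((fun r => -((σ⁻¹) ^ (2 * j) * switchTime T σ j) + (σ⁻¹) ^ (2 * j) * r) ⁻¹' Ioo (-η) (T + η))
      (pieceG T σ τ a z u j) := by
  obtain ⟨η, hη, hs⟩ := h.smooth
  exact ⟨η, hη, hs.smul_stPull _ _ _ _ _⟩

/-! ### Values of the pieces on rescaled points; continuity on the closed strips -/

/-- The `j`-th generalised piece on the point `x₀ + τʲ(y - x₀)` is `aʲ u(σ^{-2j}(t - t_j), y)`.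
[folklore] -/
private theorem pieceG_apply_center_aux (hτ : τ ≠ 0) (T σ a : ℝ) (z : EuclideanSpace ℝ (Fin 3))
    (u : ℝ → EuclideanSpace ℝ (Fin 3) → EuclideanSpace ℝ (Fin 3)) (j : ℕ) (t : ℝ)
    (y : EuclideanSpace ℝ (Fin 3)) :
    pieceG T σ τ a z u j t ((1 - τ)⁻¹ • z + τ ^ j • (y - (1 - τ)⁻¹ • z)) =
      a ^ j • u ((σ⁻¹) ^ (2 * j) * (t - switchTime T σ j)) y := by
  rw [pieceG_apply, add_sub_cancel_left, smul_smul, ← mul_pow, inv_mul_cancel₀ hτ, one_pow, one_smul,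
    add_sub_cancel]

/-- `(s, x) ↦ u^{(j)}(s, x)` is continuous on the closed `j`-th strip. [folklore] -/
private theorem continuousOn_uncurry_pieceG_aux (h : IsNSIBlock T ν₀ τ z G u) (hσ : 0 < σ) (a : ℝ)
    (j : ℕ) :
    ContinuousOn (uncurry (pieceG T σ τ a z u j))
      (Icc (switchTime T σ j) (switchTime T σ (j + 1)) ×ˢ univ) := by
  obtain ⟨η, hη, hsm⟩ := isSmoothSpaceTimeOn_pieceG_aux h σ a j
  exact hsm.continuousOn.mono (prod_mono (Icc_switchTime_subset_preimage hσ hη j) Subset.rfl)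

/-! ### `T₀` is the first blow-up time -/

/-- **The generalised glued field is bounded on `[0, T'] × ℝ³` for every `T' < T₀`** (`a ≥ 1`):
only the pieces `j < J` with `T' < t_J` are met, each bounded by `aʲ sup|u| ≤ a^J sup|u|`.
[cite: Ozanski2017NSISingular, §2.1 (p. 6)] -/
theorem exists_bound_glueG (h : IsNSIBlock T ν₀ τ z G u) (hσ₀ : 0 < σ) (hσ₁ : σ < 1) (ha : 1 ≤ a)
    (T' : ℝ) (hT' : T' < blowupTime T σ) :
    ∃ M : ℝ, ∀ t ∈ Icc 0 T', ∀ x, ‖glueG T σ τ a z u t x‖ ≤ M := by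
  obtain ⟨M₀, hM₀, hbd⟩ := h.exists_bound_norm
  obtain ⟨J, hJ⟩ : ∃ J : ℕ, T' < switchTime T σ J :=
    (((tendsto_switchTime hσ₀.le hσ₁).eventually (lt_mem_nhds hT'))).exists
  have ha0 : 0 ≤ a := zero_le_one.trans ha
  refine ⟨a ^ J * M₀, fun t ht x => ?_⟩
  by_cases htI : t ∈ Ico 0 (blowupTime T σ)
  · obtain ⟨j, hj⟩ := exists_mem_Ico_switchTime hσ₀ hσ₁ htI.1 htI.2
    have hjJ : j < J := by
      by_contra hle
      have hmono := (strictMono_switchTime h.T_pos hσ₀).monotone (not_lt.1 hle)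
      linarith [hj.1, ht.2]
    rw [glueG_eq_pieceG h.T_pos hσ₀ τ a z u hj, pieceG_apply, norm_smul,
      Real.norm_of_nonneg (pow_nonneg ha0 _)]
    have hloc : (σ⁻¹) ^ (2 * j) * (t - switchTime T σ j) ∈ Icc 0 T :=
      localTime_mem_Icc hσ₀ (Ico_subset_Icc_self hj)
    calc a ^ j * ‖u ((σ⁻¹) ^ (2 * j) * (t - switchTime T σ j))
          ((1 - τ)⁻¹ • z + (τ⁻¹) ^ j • (x - (1 - τ)⁻¹ • z))‖
        ≤ a ^ j * M₀ := mul_le_mul_of_nonneg_left (hbd _ hloc _) (pow_nonneg ha0 _)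
      _ ≤ a ^ J * M₀ := mul_le_mul_of_nonneg_right (pow_le_pow_right₀ ha hjJ.le) hM₀
  · rw [glueG_eq_zero_of_notMem_aux h.T_pos hσ₀ hσ₁ τ a z u htI]
    simpa using mul_nonneg (pow_nonneg ha0 J) hM₀

/-! ### The singular point -/

/-- **The blow-up point is singular** (`a > 1`): the generalised glued field is not essentially
bounded on any centred parabolic cylinder about `(T₀, x₀)`. With `x*` such that `u(0, x*) ≠ 0`,
the `j`-th piece equals `aʲu(0,x*)` at `(t_j, Γʲ(x*)) → (T₀, x₀)`, and by continuity `|𝔲| ≥ M + 1`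
on an open set of positive measure inside the cylinder.
[cite: Ozanski2017NSISingular, §2 pp. 6–7] [cite: Scheffer1985, Lemma 2.3 (2.30)] -/
theorem not_isRegularPoint_glueG (h : IsNSIBlock T ν₀ τ z G u) (hσ₀ : 0 < σ) (hσ₁ : σ < 1)
    (ha : 1 < a) :
    ¬ IsRegularPoint (glueG T σ τ a z u) (blowupTime T σ, blowupPoint τ z) := by
  rintro ⟨r, hr, hfin⟩
  have ha0 : 0 ≤ a := zero_le_one.trans ha.le
  -- the essential bound `M`
  set μ : Measure (ℝ × EuclideanSpace ℝ (Fin 3)) := volume.restrict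
    (parabolicCylinderCentered r ((blowupTime T σ, blowupPoint τ z) : ℝ × EuclideanSpace ℝ (Fin 3)))
    with hμ
  set M : ℝ≥0∞ := eLpNorm (uncurry (glueG T σ τ a z u)) ∞ μ with hM
  have hMfin : M < ⊤ := hfin
  have hae : ∀ᵐ q ∂μ, ‖uncurry (glueG T σ τ a z u) q‖ₑ ≤ M := by
    rw [hM, eLpNorm_exponent_top]
    exact ae_le_eLpNormEssSup
  set K : ℝ := M.toReal + 1 with hK
  have hKM : M < ENNReal.ofReal K := by
    rw [hK]
    calc M = ENNReal.ofReal M.toReal := (ENNReal.ofReal_toReal hMfin.ne).symm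
      _ < ENNReal.ofReal (M.toReal + 1) :=
        ENNReal.ofReal_lt_ofReal_iff'.2 ⟨by linarith, by linarith [ENNReal.toReal_nonneg (a := M)]⟩
  -- a point where `u(0)` does not vanish
  obtain ⟨xs, hxs⟩ := h.nontrivial
  have hpos : 0 < ‖u 0 xs‖ := norm_pos_iff.2 hxs
  -- choice of the piece index
  have ev1 : ∀ᶠ j : ℕ in atTop, blowupTime T σ - r ^ 2 < switchTime T σ j :=
    (tendsto_switchTime hσ₀.le hσ₁).eventually (lt_mem_nhds (by nlinarith))
  have ev2 : ∀ᶠ j : ℕ in atTop,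
      dist ((fun y : EuclideanSpace ℝ (Fin 3) => τ • y + z)^[j] xs) (blowupPoint τ z) < r / 2 :=
    Metric.tendsto_nhds.1 (h.tendsto_similarity_iterate xs) (r / 2) (by positivity)
  have ev3 : ∀ᶠ j : ℕ in atTop, K < a ^ j * ‖u 0 xs‖ :=
    ((tendsto_pow_atTop_atTop_of_one_lt ha).atTop_mul_const hpos).eventually_gt_atTop K
  obtain ⟨j, hj1, hj2, hj3⟩ := (ev1.and (ev2.and ev3)).exists
  -- the point `(t_j, Γʲ(x*))` and the value of the `j`-th piece there
  set tj : ℝ := switchTime T σ j with htj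
  set xj : EuclideanSpace ℝ (Fin 3) := (fun y : EuclideanSpace ℝ (Fin 3) => τ • y + z)^[j] xs
    with hxj
  have hlt : tj < switchTime T σ (j + 1) := strictMono_switchTime h.T_pos hσ₀ (Nat.lt_succ_self j)
  have hval : pieceG T σ τ a z u j tj xj = a ^ j • u 0 xs := by
    rw [hxj, similarity_iterate_eq h.τ_lt_one.ne z xs j, pieceG_apply_center_aux h.τ_pos.ne', htj,
      sub_self, mul_zero]
  have hnorm : K < ‖uncurry (pieceG T σ τ a z u j) (tj, xj)‖ := by
    simp only [uncurry_apply_pair, hval, norm_smul, Real.norm_of_nonneg (pow_nonneg ha0 j)]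
    exact hj3
  -- continuity of the piece on its closed strip gives a neighbourhood where `|u^{(j)}| > K`
  have hcont := continuousOn_uncurry_pieceG_aux h hσ₀ a j
  have hmem : ((tj, xj) : ℝ × EuclideanSpace ℝ (Fin 3)) ∈ Icc tj (switchTime T σ (j + 1)) ×ˢ univ :=
    ⟨⟨le_rfl, hlt.le⟩, mem_univ _⟩
  have hpre : (fun q => ‖uncurry (pieceG T σ τ a z u j) q‖) ⁻¹' Ioi K ∈
      𝓝[Icc tj (switchTime T σ (j + 1)) ×ˢ univ] ((tj, xj) : ℝ × EuclideanSpace ℝ (Fin 3)) :=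
    ((hcont (tj, xj) hmem).norm).preimage_mem_nhdsWithin (Ioi_mem_nhds hnorm)
  obtain ⟨δ, hδ, hball⟩ := Metric.mem_nhdsWithin_iff.1 hpre
  -- the small open box `U` inside the strip, the neighbourhood and the cylinder
  set δ' : ℝ := min δ (min (r / 2) (switchTime T σ (j + 1) - tj)) with hδ'
  have hδ'pos : 0 < δ' := lt_min hδ (lt_min (by positivity) (sub_pos.2 hlt))
  have hδ'δ : δ' ≤ δ := min_le_left _ _
  have hδ'r : δ' ≤ r / 2 := (min_le_right _ _).trans (min_le_left _ _)
  have hδ't : δ' ≤ switchTime T σ (j + 1) - tj := (min_le_right _ _).trans (min_le_right _ _)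
  set U : Set (ℝ × EuclideanSpace ℝ (Fin 3)) := Ioo tj (tj + δ') ×ˢ ball xj δ' with hU
  have hUmeas : MeasurableSet U := measurableSet_Ioo.prod measurableSet_ball
  -- `U` lies in the cylinder
  have hUQ : U ⊆ parabolicCylinderCentered r
      ((blowupTime T σ, blowupPoint τ z) : ℝ × EuclideanSpace ℝ (Fin 3)) := by
    rintro ⟨s, x⟩ ⟨hs, hx⟩
    rw [mem_parabolicCylinderCentered]
    refine ⟨⟨by linarith [hs.1], ?_⟩, ?_⟩
    · have := switchTime_lt_blowupTime h.T_pos hσ₀ hσ₁ (j + 1)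
      have hr2 : 0 < r ^ 2 := by positivity
      simp only
      linarith [hs.2]
    · calc dist x (blowupPoint τ z) ≤ dist x xj + dist xj (blowupPoint τ z) := dist_triangle _ _ _
        _ < δ' + r / 2 := add_lt_add (mem_ball.1 hx) hj2
        _ ≤ r := by linarith
  -- on `U` the glued field is the `j`-th piece and exceeds `K`
  have hUK : ∀ q ∈ U, K < ‖uncurry (glueG T σ τ a z u) q‖ := by
    rintro ⟨s, x⟩ ⟨hs, hx⟩
    have hsI : s ∈ Ico tj (switchTime T σ (j + 1)) := ⟨hs.1.le, by linarith [hs.2]⟩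
    have hq : ((s, x) : ℝ × EuclideanSpace ℝ (Fin 3)) ∈
        ball ((tj, xj) : ℝ × EuclideanSpace ℝ (Fin 3)) δ ∩
          (Icc tj (switchTime T σ (j + 1)) ×ˢ univ) := by
      refine ⟨?_, ⟨Ico_subset_Icc_self hsI, mem_univ _⟩⟩
      rw [mem_ball, Prod.dist_eq, max_lt_iff]
      refine ⟨?_, (mem_ball.1 hx).trans_le hδ'δ⟩
      rw [Real.dist_eq, abs_of_pos (sub_pos.2 hs.1)]
      linarith [hs.2]
    have := hball hq
    simp only [mem_preimage, mem_Ioi, uncurry_apply_pair] at this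
    simpa only [uncurry_apply_pair, glueG_eq_pieceG h.T_pos hσ₀ τ a z u hsI] using this
  -- `U` has positive measure ...
  have hUpos : 0 < μ U := by
    rw [hμ, Measure.restrict_apply hUmeas, inter_eq_left.2 hUQ, hU, Measure.volume_eq_prod,
      Measure.prod_prod, Real.volume_Ioo, add_sub_cancel_left]
    exact ENNReal.mul_pos (ENNReal.ofReal_pos.2 hδ'pos).ne' (measure_ball_pos volume xj hδ'pos).ne'
  -- ... but the essential bound forces it to be null
  have hU0 : μ U = 0 := by
    rw [ae_iff] at hae
    refine measure_mono_null (fun q hq => ?_) hae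
    simp only [mem_setOf_eq, not_le]
    calc M < ENNReal.ofReal K := hKM
      _ ≤ ENNReal.ofReal ‖uncurry (glueG T σ τ a z u) q‖ := ENNReal.ofReal_le_ofReal (hUK q hq).le
      _ = ‖uncurry (glueG T σ τ a z u) q‖ₑ := ofReal_norm _
  exact absurd hU0 hUpos.ne'

/-! ### The super-`1/2` blow-up rate -/

/-- **Uniform nontriviality of an NSI block**: `inf_{s ∈ [0,T]} max_y ‖u(s,y)‖ > 0`, i.e. there
is `m > 0` such that every slice `u(s)`, `s ∈ [0,T]`, has a point with `‖u(s,y)‖ ≥ m`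
(compactness of `[0,T]`, joint continuity, and `tsupport u(s) = G ∋ x*`). [folklore] -/
theorem exists_pos_forall_exists_le_norm (h : IsNSIBlock T ν₀ τ z G u) :
    ∃ m : ℝ, 0 < m ∧ ∀ s ∈ Icc 0 T, ∃ y, m ≤ ‖u s y‖ := by
  by_contra H
  push Not at H
  -- a sequence of slices with `sup ‖u(s_n)‖ < 1/(n+1)`
  have hseq : ∀ n : ℕ, ∃ s ∈ Icc 0 T, ∀ y, ‖u s y‖ < 1 / ((n : ℝ) + 1) := fun n =>
    H _ (by positivity)
  choose s hs hsmall using hseq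
  obtain ⟨s₀, hs₀, φ, hφ, hlim⟩ := isCompact_Icc.tendsto_subseq hs
  -- every value of the limit slice vanishes
  have hzero : ∀ y, u s₀ y = 0 := by
    intro y
    have hcont : ContinuousOn (uncurry u ∘ fun r : ℝ => ((r, y) : ℝ × EuclideanSpace ℝ (Fin 3)))
        (Icc 0 T) :=
      h.continuousOn_uncurry.comp (continuous_id.prodMk continuous_const).continuousOn
        fun r hr => ⟨hr, mem_univ _⟩
    have hlim' : Tendsto (fun n => u (s (φ n)) y) atTop (𝓝 (u s₀ y)) := by
      have := (hcont s₀ hs₀).tendsto.comp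
        (tendsto_nhdsWithin_iff.2 ⟨hlim, Eventually.of_forall fun n => hs (φ n)⟩)
      simpa [Function.comp_def] using this
    have hnorm : Tendsto (fun n => ‖u (s (φ n)) y‖) atTop (𝓝 0) := by
      have hφt : Tendsto (fun n => 1 / ((φ n : ℝ) + 1)) atTop (𝓝 0) :=
        (tendsto_one_div_add_atTop_nhds_zero_nat (𝕜 := ℝ)).comp hφ.tendsto_atTop
      exact squeeze_zero (fun n => norm_nonneg _) (fun n => (hsmall (φ n) y).le) hφt
    exact norm_eq_zero.1 (tendsto_nhds_unique hlim'.norm hnorm)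
  -- but `tsupport u(s₀) = G` contains `x*` with `u(0,x*) ≠ 0`
  obtain ⟨xs, hxs⟩ := h.nontrivial
  have hxG : xs ∈ G := by
    rw [← h.tsupport_eq 0 ⟨le_rfl, h.T_pos.le⟩]
    exact subset_tsupport _ (mem_support.2 hxs)
  have hsupp : tsupport (u s₀) = ∅ := by
    rw [tsupport, show support (u s₀) = ∅ from support_eq_empty_iff.2 (funext hzero), closure_empty]
  rw [h.tsupport_eq s₀ hs₀] at hsupp
  exact (hsupp ▸ hxG : xs ∈ (∅ : Set (EuclideanSpace ℝ (Fin 3))))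

/-- **The super-`1/2` rate of the generalised glued field** (`0 < σ < 1`, `aσ > 1`): with
`β = log_{σ⁻²} a` (so `(σ⁻²)^β = a`, and `β > 1/2 ⇔ a > σ⁻¹`) there is `c > 0` such that at every
`t ∈ [0, T₀)` some point has `c (T₀ - t)^{-β} ≤ ‖𝔲(t, x)‖`: on the `j`-th life span,
`T₀ - t > T₀ - t_{j+1} = σ^{2(j+1)}T₀`, so `(T₀ - t)^{-β} < a^{j+1} T₀^{-β}`, while
`‖u^{(j)}(t, Γʲy)‖ = aʲ‖u(s,y)‖ ≥ aʲ m`. [cite: Ozanski2017NSISingular, §2.1 (p. 6)] -/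
theorem exists_rate_glueG (h : IsNSIBlock T ν₀ τ z G u) (hσ₀ : 0 < σ) (hσ₁ : σ < 1)
    (haσ : 1 < a * σ) :
    ∃ β c : ℝ, 1 / 2 < β ∧ 0 < c ∧
      ∀ t ∈ Ico 0 (blowupTime T σ), ∃ x, c * (blowupTime T σ - t) ^ (-β) ≤ ‖glueG T σ τ a z u t x‖ := by
  have ha : 0 < a := (mul_pos_iff_of_pos_right hσ₀).1 (zero_lt_one.trans haσ)
  obtain ⟨m, hm, hmu⟩ := exists_pos_forall_exists_le_norm h
  -- the base `b = σ⁻² > 1` and the exponent `β = log_b a`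
  set b : ℝ := (σ⁻¹) ^ 2 with hb
  have hσinv : 1 < σ⁻¹ := (one_lt_inv₀ hσ₀).2 hσ₁
  have hb1 : 1 < b := by rw [hb]; nlinarith
  have hb0 : 0 < b := one_pos.trans hb1
  set β : ℝ := Real.logb b a with hβ
  have hbβ : b ^ β = a := Real.rpow_logb hb0 hb1.ne' ha
  have hβhalf : 1 / 2 < β := by
    rw [hβ, Real.lt_logb_iff_rpow_lt hb1 ha]
    have : b ^ (1 / 2 : ℝ) = σ⁻¹ := by
      rw [hb, ← Real.sqrt_eq_rpow, Real.sqrt_sq (inv_pos.2 hσ₀).le]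
    rw [this]
    have := mul_lt_mul_of_pos_right haσ (inv_pos.2 hσ₀)
    rwa [one_mul, mul_assoc, mul_inv_cancel₀ hσ₀.ne', mul_one] at this
  have hβ0 : 0 < β := by linarith
  have hT₀ : 0 < blowupTime T σ := div_pos h.T_pos (by nlinarith)
  -- the constant
  refine ⟨β, m * a⁻¹ * (blowupTime T σ) ^ β, hβhalf, by positivity, fun t ht => ?_⟩
  obtain ⟨j, hj⟩ := exists_mem_Ico_switchTime hσ₀ hσ₁ ht.1 ht.2
  -- the local time and a point of the slice with `‖u‖ ≥ m`
  have hloc : (σ⁻¹) ^ (2 * j) * (t - switchTime T σ j) ∈ Icc 0 T :=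
    localTime_mem_Icc hσ₀ (Ico_subset_Icc_self hj)
  obtain ⟨y, hy⟩ := hmu _ hloc
  refine ⟨(1 - τ)⁻¹ • z + τ ^ j • (y - (1 - τ)⁻¹ • z), ?_⟩
  rw [glueG_eq_pieceG h.T_pos hσ₀ τ a z u hj, pieceG_apply_center_aux h.τ_pos.ne', norm_smul,
    Real.norm_of_nonneg (pow_nonneg ha.le _)]
  -- `(T₀ - t)^{-β} ≤ (σ^{2(j+1)} T₀)^{-β} = a^{j+1} T₀^{-β}`
  have hσ2 : σ ^ 2 ≠ 1 := (pow_lt_one₀ hσ₀.le hσ₁ two_ne_zero).ne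
  have hgap : blowupTime T σ - switchTime T σ (j + 1) = σ ^ (2 * (j + 1)) * blowupTime T σ :=
    blowupTime_sub_switchTime T hσ2 (j + 1)
  have hpos1 : 0 < σ ^ (2 * (j + 1)) * blowupTime T σ := by positivity
  have hle1 : σ ^ (2 * (j + 1)) * blowupTime T σ ≤ blowupTime T σ - t := by
    rw [← hgap]; linarith [hj.2]
  have hanti : (blowupTime T σ - t) ^ (-β) ≤ (σ ^ (2 * (j + 1)) * blowupTime T σ) ^ (-β) :=
    Real.rpow_le_rpow_of_nonpos hpos1 hle1 (by linarith)
  have hpow : (σ ^ (2 * (j + 1))) ^ (-β) = a ^ (j + 1) := by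
    have e1 : σ ^ (2 * (j + 1)) = (b ^ (j + 1))⁻¹ := by
      rw [hb, ← pow_mul, inv_pow, inv_inv]
    rw [e1, Real.inv_rpow (pow_nonneg hb0.le _), Real.rpow_neg (pow_nonneg hb0.le _), inv_inv,
      ← Real.rpow_natCast b (j + 1), ← Real.rpow_mul hb0.le, mul_comm, Real.rpow_mul hb0.le, hbβ,
      Real.rpow_natCast]
  have hkey : (σ ^ (2 * (j + 1)) * blowupTime T σ) ^ (-β) = a ^ (j + 1) * (blowupTime T σ) ^ (-β) := by
    rw [Real.mul_rpow (pow_nonneg hσ₀.le _) hT₀.le, hpow]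
  -- assemble: `c (T₀-t)^{-β} ≤ c a^{j+1} T₀^{-β} = m aʲ ≤ aʲ ‖u(s,y)‖`
  calc m * a⁻¹ * blowupTime T σ ^ β * (blowupTime T σ - t) ^ (-β)
      ≤ m * a⁻¹ * blowupTime T σ ^ β * (a ^ (j + 1) * (blowupTime T σ) ^ (-β)) := by
        rw [← hkey]; exact mul_le_mul_of_nonneg_left hanti (by positivity)
    _ = a ^ j * m := by
        rw [Real.rpow_neg hT₀.le, pow_succ]
        field_simp
    _ ≤ a ^ j * ‖u ((σ⁻¹) ^ (2 * j) * (t - switchTime T σ j)) y‖ :=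
        mul_le_mul_of_nonneg_left hy (pow_nonneg ha.le _)

end Summit.NavierStokesRegularity.NavierStokesRegularity.Theorems.TypeIliouvilleNoTypeIINegative

end
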